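import Mathlib

/-!
# Torus-cube obstruction for level-`k` identity tests (negative lemma, crux `SubgroupIdentityDesigns`, 14079)

Level `k` on `M_m(𝔽_p)`: `f = Σ_{rk M ≤ k} c_M ψ(tr(M·))`.  Fix `k+1` coordinates `I₀`, the unitriangular
block `U_{I₀} = 1 + 𝔫_{I₀}` (strictly upper triangular supported on `I₀ × I₀`) and a CUBE of diagonal
torus elements `t_ε` (`ε : I₀ → Bool`) taking non-zero values `α i` / `β i` on `I₀` (`α` off `I₀`).
* `torusCube_sum_eq_zero`: `Σ_ε sgn(ε) Σ_n f(t_ε (1 + n)) = 0` for every rank-`≤ k`-supported `c`.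
  Fourier proof: `Σ_n ψ(tr(M t (1+n))) = p^{·} ψ(Σ_a M_aa t_a) [M_ab = 0, a > b ∈ I₀]`, the signed cube
  sum of the phase factorises as `Π_{i∈I₀}(ψ(M_ii α_i) − ψ(M_ii β_i))`, non-zero only if `M_ii ≠ 0` on
  `I₀`; then the `I₀ × I₀` block of `M` is invertible upper triangular, `rk M ≥ k+1`, `c_M = 0`.
* `no_idTest_of_torusCube`: so no level-`k` function is `1` at `1` and `0` on the rest of a set
  `S ⊆ M_m(𝔽_p)` containing all points `t_ε(1+n)` when `1` is a cube vertex (`α ≠ β` on `I₀`).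
The first obstruction of the chain using the STRUCTURE of `F_k` (not only `dim F_k`): the tested set
`H₁H₂H₃` of a level-`k` subgroup identity design contains no split `(k+1)`-torus cube of `U_{I₀}`-cosets
through `1` (nor any conjugate / two-sided translate, by bi-invariance) — the card's "torus rule" as a
theorem; it explains this seat's zoo j011435 (`(U⁻μ_d, ⟨w⟩, U⁺μ'_{d'})` fails exactly when `d, d' ≥ 2`)
and is vacuous at `p = 2`.  Sorry-free; standard axioms.
-/

set_option linter.dupNamespace false

noncomputable section

open scoped BigOperators Classical

namespace Summit.MatrixMultiplication.MatrixMultiplication.Theorems.SubgroupIdentityDesigns.Negative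

variable {p m : ℕ} [Fact p.Prime]

/-- `M_m(𝔽_p)`. -/
abbrev CMat (p m : ℕ) : Type := Matrix (Fin m) (Fin m) (ZMod p)

/-- The Fourier function `g ↦ Σ_M c_M ψ(tr(M g))` on MATRICES (the crux's clause on `GL_m`). -/
def fourierMat (c : CMat p m → ℂ) (g : CMat p m) : ℂ :=
  ∑ M : CMat p m, c M * ZMod.stdAddChar (Matrix.trace (M * g))

/-- The strictly upper triangular block on `I₀ × I₀` with entries read off `e` (else `0`). -/
def cubeNil (I₀ : Finset (Fin m)) (e : CMat p m) : CMat p m :=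
  Matrix.of fun a b => if a ∈ I₀ ∧ b ∈ I₀ ∧ a < b then e a b else 0

/-- The torus vertex `t_ε`: `α i` or `β i` on `I₀` according to `ε`, `α i` off `I₀`. -/
def cubeTorus (I₀ : Finset (Fin m)) (α β : Fin m → ZMod p) (ε : ↥I₀ → Bool) : Fin m → ZMod p :=
  fun i => if h : i ∈ I₀ then (if ε ⟨i, h⟩ then α i else β i) else α i

/-- The sign of a cube vertex: `Π_{i ∈ I₀} (±1)`. -/
def cubeSign {I₀ : Finset (Fin m)} (ε : ↥I₀ → Bool) : ℂ :=
  ∏ i : ↥I₀, (if ε i then (1 : ℂ) else -1)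

/-- The cube point `t_ε · (1 + n_e)`. -/
def cubePt (I₀ : Finset (Fin m)) (α β : Fin m → ZMod p) (ε : ↥I₀ → Bool) (e : CMat p m) : CMat p m :=
  Matrix.diagonal (cubeTorus I₀ α β ε) * (1 + cubeNil I₀ e)

/-- `ψ` turns finite sums into products (the standard additive character of `𝔽_p`). [folklore] -/
theorem stdAddChar_map_sum {ι : Type*} (s : Finset ι) (x : ι → ZMod p) :
    ZMod.stdAddChar (∑ i ∈ s, x i) = ∏ i ∈ s, ZMod.stdAddChar (x i) := by
  induction s using Finset.cons_induction with
  | empty => simp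
  | cons a s ha ih => rw [Finset.sum_cons, Finset.prod_cons, AddChar.map_add_eq_mul, ih]

/-- The trace of `M · t · (1 + n_e)`: diagonal phase plus the pattern entries. -/
theorem trace_mul_cubePt (I₀ : Finset (Fin m)) (τ : Fin m → ZMod p) (e M : CMat p m) :
    Matrix.trace (M * (Matrix.diagonal τ * (1 + cubeNil I₀ e))) =
      (∑ a : Fin m, M a a * τ a) +
        ∑ a : Fin m, ∑ b : Fin m, (if b ∈ I₀ ∧ a ∈ I₀ ∧ b < a then M a b * τ b * e b a else 0) := by
  have hY : ∀ b a : Fin m, (Matrix.diagonal τ * (1 + cubeNil I₀ e)) b a =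
      τ b * ((if b = a then 1 else 0) + (if b ∈ I₀ ∧ a ∈ I₀ ∧ b < a then e b a else 0)) := by
    intro b a
    rw [Matrix.diagonal_mul, Matrix.add_apply, Matrix.one_apply]
    rfl
  simp only [Matrix.trace, Matrix.diag_apply, Matrix.mul_apply, hY]
  rw [← Finset.sum_add_distrib]
  refine Finset.sum_congr rfl fun a _ => ?_
  have : ∀ b : Fin m, M a b * (τ b * ((if b = a then 1 else 0) +
      if b ∈ I₀ ∧ a ∈ I₀ ∧ b < a then e b a else 0)) =
      (if b = a then M a a * τ a else 0) +
        (if b ∈ I₀ ∧ a ∈ I₀ ∧ b < a then M a b * τ b * e b a else 0) := by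
    intro b
    by_cases hba : b = a
    · subst hba
      have hirr : ¬ (b ∈ I₀ ∧ b ∈ I₀ ∧ b < b) := fun h => lt_irrefl _ h.2.2
      rw [if_pos rfl, if_pos rfl, if_neg hirr, if_neg hirr]
      ring
    · simp only [if_neg hba, zero_add]
      split_ifs <;> ring
  rw [Finset.sum_congr rfl fun b _ => this b, Finset.sum_add_distrib, Finset.sum_ite_eq' Finset.univ a,
    if_pos (Finset.mem_univ a)]

/-- Orthogonality: `Σ_{x ∈ 𝔽_p} ψ(a x) = p·[a = 0]`. [folklore] -/
theorem sum_psi_mul (a : ZMod p) :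
    ∑ x : ZMod p, ZMod.stdAddChar (a * x) = if a = 0 then (p : ℂ) else 0 := by
  have h := AddChar.sum_mulShift (R := ZMod p) a (ZMod.isPrimitive_stdAddChar p)
  calc (∑ x : ZMod p, ZMod.stdAddChar (a * x)) = ∑ x : ZMod p, ZMod.stdAddChar (x * a) := by
        simp_rw [mul_comm a]
    _ = _ := by rw [h]; split_ifs <;> simp [ZMod.card]

/-- **Summing the pattern entries**: for a fixed torus point `τ` non-zero on `I₀`,
`Σ_e ψ(tr(M τ (1 + n_e))) = ψ(Σ_a M_aa τ_a) · p^{m²} · [M_ab = 0 whenever a > b, a, b ∈ I₀]`. -/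
theorem sum_psi_trace_cubePt (I₀ : Finset (Fin m)) (τ : Fin m → ZMod p) (hτ : ∀ i ∈ I₀, τ i ≠ 0)
    (M : CMat p m) :
    ∑ e : CMat p m, ZMod.stdAddChar (Matrix.trace (M * (Matrix.diagonal τ * (1 + cubeNil I₀ e)))) =
      ZMod.stdAddChar (∑ a : Fin m, M a a * τ a) *
        (if ∀ a b : Fin m, (b ∈ I₀ ∧ a ∈ I₀ ∧ b < a) → M a b = 0 then ((p : ℂ) ^ (m * m)) else 0) := by
  have hexp : ∀ e : CMat p m,
      ZMod.stdAddChar (Matrix.trace (M * (Matrix.diagonal τ * (1 + cubeNil I₀ e)))) =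
        ZMod.stdAddChar (∑ a : Fin m, M a a * τ a) *
          ∏ a : Fin m, ∏ b : Fin m,
            ZMod.stdAddChar (if b ∈ I₀ ∧ a ∈ I₀ ∧ b < a then M a b * τ b * e b a else 0) := by
    intro e
    rw [trace_mul_cubePt, AddChar.map_add_eq_mul]
    congr 1
    rw [stdAddChar_map_sum]
    exact Finset.prod_congr rfl fun a _ => stdAddChar_map_sum _ _
  simp_rw [hexp]
  rw [← Finset.mul_sum]
  congr 1
  have hswap : (∑ e : CMat p m, ∏ a : Fin m, ∏ b : Fin m,
      ZMod.stdAddChar (if b ∈ I₀ ∧ a ∈ I₀ ∧ b < a then M a b * τ b * e b a else 0)) =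
      ∏ a : Fin m, ∏ b : Fin m, ∑ x : ZMod p,
        ZMod.stdAddChar (if b ∈ I₀ ∧ a ∈ I₀ ∧ b < a then M a b * τ b * x else 0) := by
    calc (∑ e : CMat p m, ∏ a : Fin m, ∏ b : Fin m,
          ZMod.stdAddChar (if b ∈ I₀ ∧ a ∈ I₀ ∧ b < a then M a b * τ b * e b a else 0))
        = ∑ e : CMat p m, ∏ b : Fin m, ∏ a : Fin m,
            ZMod.stdAddChar (if b ∈ I₀ ∧ a ∈ I₀ ∧ b < a then M a b * τ b * e b a else 0) := by
          refine Finset.sum_congr rfl fun e _ => Finset.prod_comm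
      _ = ∑ f : Fin m → Fin m → ZMod p, ∏ b : Fin m, ∏ a : Fin m,
            ZMod.stdAddChar (if b ∈ I₀ ∧ a ∈ I₀ ∧ b < a then M a b * τ b * f b a else 0) := by
          rw [← Equiv.sum_comp Matrix.of]
          rfl
      _ = ∏ b : Fin m, ∑ g : Fin m → ZMod p, ∏ a : Fin m,
            ZMod.stdAddChar (if b ∈ I₀ ∧ a ∈ I₀ ∧ b < a then M a b * τ b * g a else 0) :=
          (Fintype.prod_sum (fun b (g : Fin m → ZMod p) => ∏ a : Fin m,
              ZMod.stdAddChar (if b ∈ I₀ ∧ a ∈ I₀ ∧ b < a then M a b * τ b * g a else 0))).symm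
      _ = ∏ b : Fin m, ∏ a : Fin m, ∑ x : ZMod p,
            ZMod.stdAddChar (if b ∈ I₀ ∧ a ∈ I₀ ∧ b < a then M a b * τ b * x else 0) := by
          refine Finset.prod_congr rfl fun b _ => ?_
          exact (Fintype.prod_sum (fun a (x : ZMod p) =>
            ZMod.stdAddChar (if b ∈ I₀ ∧ a ∈ I₀ ∧ b < a then M a b * τ b * x else 0))).symm
      _ = _ := Finset.prod_comm
  rw [hswap]
  have hfac : ∀ a b : Fin m, (∑ x : ZMod p,
      ZMod.stdAddChar (if b ∈ I₀ ∧ a ∈ I₀ ∧ b < a then M a b * τ b * x else 0)) =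
        if (b ∈ I₀ ∧ a ∈ I₀ ∧ b < a) → M a b = 0 then (p : ℂ) else 0 := by
    intro a b
    by_cases hc : b ∈ I₀ ∧ a ∈ I₀ ∧ b < a
    · simp only [if_pos hc]
      rw [sum_psi_mul]
      have hτb : τ b ≠ 0 := hτ b hc.1
      by_cases hM : M a b = 0
      · rw [if_pos (by rw [hM, zero_mul]), if_pos (fun _ => hM)]
      · rw [if_neg (mul_ne_zero hM hτb), if_neg (fun h => hM (h hc))]
    · simp only [if_neg hc, AddChar.map_zero_eq_one, Finset.sum_const, Finset.card_univ, ZMod.card,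
        nsmul_eq_mul, mul_one]
      rw [if_pos (fun h => absurd h hc)]
  simp_rw [hfac]
  by_cases hall : ∀ a b : Fin m, (b ∈ I₀ ∧ a ∈ I₀ ∧ b < a) → M a b = 0
  · rw [if_pos hall]
    rw [Finset.prod_congr rfl fun a _ => Finset.prod_congr rfl fun b _ => if_pos (hall a b)]
    simp [Finset.prod_const, Finset.card_univ, Fintype.card_fin, pow_mul]
  · rw [if_neg hall]
    push Not at hall
    obtain ⟨a, b, hab, hM⟩ := hall
    apply Finset.prod_eq_zero (Finset.mem_univ a)
    apply Finset.prod_eq_zero (Finset.mem_univ b)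
    rw [if_neg (fun h => hM (h hab))]

/-- **The signed cube sum of the diagonal phase factorises**:
`Σ_ε sgn(ε) ψ(Σ_a M_aa t_ε,a) = ψ(Σ_{a ∉ I₀} M_aa α_a) · Π_{i ∈ I₀} (ψ(M_ii α_i) − ψ(M_ii β_i))`. -/
theorem cube_signed_phase (I₀ : Finset (Fin m)) (α β : Fin m → ZMod p) (M : CMat p m) :
    ∑ ε : ↥I₀ → Bool, cubeSign ε * ZMod.stdAddChar (∑ a : Fin m, M a a * cubeTorus I₀ α β ε a) =
      ZMod.stdAddChar (∑ a ∈ I₀ᶜ, M a a * α a) *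
        ∏ i : ↥I₀, (ZMod.stdAddChar (M i i * α i) - ZMod.stdAddChar (M i i * β i)) := by
  have hsplit : ∀ ε : ↥I₀ → Bool, ZMod.stdAddChar (∑ a : Fin m, M a a * cubeTorus I₀ α β ε a) =
      ZMod.stdAddChar (∑ a ∈ I₀ᶜ, M a a * α a) *
        ∏ i : ↥I₀, ZMod.stdAddChar (M i i * (if ε i then α i else β i)) := by
    intro ε
    rw [show (∑ a : Fin m, M a a * cubeTorus I₀ α β ε a) =
        (∑ a ∈ I₀ᶜ, M a a * cubeTorus I₀ α β ε a) + ∑ a ∈ I₀, M a a * cubeTorus I₀ α β ε a by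
      rw [add_comm, Finset.sum_add_sum_compl], AddChar.map_add_eq_mul]
    congr 1
    · congr 1
      refine Finset.sum_congr rfl fun a ha => ?_
      rw [Finset.mem_compl] at ha
      simp [cubeTorus, ha]
    · rw [stdAddChar_map_sum, ← Finset.prod_coe_sort I₀]
      refine Finset.prod_congr rfl fun i _ => ?_
      simp [cubeTorus, i.2]
  simp_rw [hsplit]
  have hcomm : ∀ ε : ↥I₀ → Bool, cubeSign ε * (ZMod.stdAddChar (∑ a ∈ I₀ᶜ, M a a * α a) *
      ∏ i : ↥I₀, ZMod.stdAddChar (M i i * (if ε i then α i else β i))) =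
      ZMod.stdAddChar (∑ a ∈ I₀ᶜ, M a a * α a) *
        ∏ i : ↥I₀, ((if ε i then (1 : ℂ) else -1) * ZMod.stdAddChar (M i i * (if ε i then α i else β i))) := by
    intro ε
    rw [cubeSign, Finset.prod_mul_distrib]
    ring
  simp_rw [hcomm]
  rw [← Finset.mul_sum]
  congr 1
  rw [← Fintype.prod_sum (fun (i : ↥I₀) (b : Bool) =>
    (if b then (1 : ℂ) else -1) * ZMod.stdAddChar (M i i * (if b then α i else β i)))]
  refine Finset.prod_congr rfl fun i _ => ?_
  simp [sub_eq_add_neg]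

/-- If `M` is upper triangular on `I₀ × I₀` with non-zero diagonal entries there, then
`|I₀| ≤ rk M` (the `I₀ × I₀` submatrix is invertible). [folklore] -/
theorem card_le_rank_of_triangular_block (I₀ : Finset (Fin m)) (M : CMat p m)
    (hup : ∀ a b : Fin m, (b ∈ I₀ ∧ a ∈ I₀ ∧ b < a) → M a b = 0)
    (hdiag : ∀ i ∈ I₀, M i i ≠ 0) : I₀.card ≤ M.rank := by
  let sub : Matrix ↥I₀ ↥I₀ (ZMod p) := M.submatrix Subtype.val Subtype.val
  have htri : sub.BlockTriangular id := by
    intro i j hij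
    exact hup i j ⟨j.2, i.2, hij⟩
  have hdet : sub.det ≠ 0 := by
    rw [Matrix.det_of_upperTriangular htri]
    exact Finset.prod_ne_zero_iff.2 fun i _ => hdiag i i.2
  have hunit : IsUnit sub := (Matrix.isUnit_iff_isUnit_det _).2 (isUnit_iff_ne_zero.2 hdet)
  have hrank : sub.rank = I₀.card := by
    rw [Matrix.rank_of_isUnit _ hunit, Fintype.card_coe]
  calc I₀.card = sub.rank := hrank.symm
    _ ≤ M.rank := Matrix.rank_submatrix_le M Subtype.val Subtype.val

/-- **TORUS-CUBE SUM VANISHES ON LEVEL `k`.**  For every coefficient table supported in rank `≤ k`,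
`|I₀| = k + 1`, and torus values `α, β` non-zero on `I₀` (distinctness is not even needed here):
`Σ_ε sgn(ε) Σ_e f(t_ε (1 + n_e)) = 0`  (`e` runs over all matrices; `n_e` reads only the pattern
entries, so each point of `t_ε U_{I₀}` is counted `p^{m² − |pattern|}` times). -/
theorem torusCube_sum_eq_zero (k : ℕ) (I₀ : Finset (Fin m)) (hI : I₀.card = k + 1)
    (α β : Fin m → ZMod p) (hα : ∀ i ∈ I₀, α i ≠ 0) (hβ : ∀ i ∈ I₀, β i ≠ 0)
    (c : CMat p m → ℂ) (hc : ∀ M : CMat p m, k < M.rank → c M = 0) :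
    ∑ ε : ↥I₀ → Bool, ∑ e : CMat p m, cubeSign ε * fourierMat c (cubePt I₀ α β ε e) = 0 := by
  set F : (↥I₀ → Bool) → CMat p m → CMat p m → ℂ := fun ε e M =>
    cubeSign ε * (c M * ZMod.stdAddChar (Matrix.trace (M * cubePt I₀ α β ε e))) with hF
  have h1 : ∀ (ε : ↥I₀ → Bool) (e : CMat p m),
      cubeSign ε * fourierMat c (cubePt I₀ α β ε e) = ∑ M : CMat p m, F ε e M := by
    intro ε e
    rw [fourierMat, Finset.mul_sum]
  have h2 : ∀ M : CMat p m, c M * (∑ ε : ↥I₀ → Bool, cubeSign ε *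
      ∑ e : CMat p m, ZMod.stdAddChar (Matrix.trace (M * cubePt I₀ α β ε e))) =
      ∑ ε : ↥I₀ → Bool, ∑ e : CMat p m, F ε e M := by
    intro M
    rw [Finset.mul_sum]
    refine Finset.sum_congr rfl fun ε _ => ?_
    rw [Finset.mul_sum, Finset.mul_sum]
    refine Finset.sum_congr rfl fun e _ => ?_
    rw [hF]
    ring
  have hre : (∑ ε : ↥I₀ → Bool, ∑ e : CMat p m, cubeSign ε * fourierMat c (cubePt I₀ α β ε e)) =
      ∑ M : CMat p m, c M * ∑ ε : ↥I₀ → Bool, cubeSign ε *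
        ∑ e : CMat p m, ZMod.stdAddChar (Matrix.trace (M * cubePt I₀ α β ε e)) := by
    simp_rw [h1, h2]
    calc (∑ ε : ↥I₀ → Bool, ∑ e : CMat p m, ∑ M : CMat p m, F ε e M)
        = ∑ ε : ↥I₀ → Bool, ∑ M : CMat p m, ∑ e : CMat p m, F ε e M :=
          Finset.sum_congr rfl fun ε _ => Finset.sum_comm
      _ = ∑ M : CMat p m, ∑ ε : ↥I₀ → Bool, ∑ e : CMat p m, F ε e M := Finset.sum_comm
  rw [hre]
  refine Finset.sum_eq_zero fun M _ => ?_
  have hτ : ∀ ε : ↥I₀ → Bool, ∀ i ∈ I₀, cubeTorus I₀ α β ε i ≠ 0 := by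
    intro ε i hi
    simp only [cubeTorus, dif_pos hi]
    split_ifs
    · exact hα i hi
    · exact hβ i hi
  have hinner : ∀ ε : ↥I₀ → Bool,
      (∑ e : CMat p m, ZMod.stdAddChar (Matrix.trace (M * cubePt I₀ α β ε e))) =
        ZMod.stdAddChar (∑ a : Fin m, M a a * cubeTorus I₀ α β ε a) *
          (if ∀ a b : Fin m, (b ∈ I₀ ∧ a ∈ I₀ ∧ b < a) → M a b = 0 then ((p : ℂ) ^ (m * m)) else 0) :=
    fun ε => sum_psi_trace_cubePt I₀ _ (hτ ε) M
  simp_rw [hinner]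
  by_cases hup : ∀ a b : Fin m, (b ∈ I₀ ∧ a ∈ I₀ ∧ b < a) → M a b = 0
  · simp only [if_pos hup]
    have hfac : (∑ ε : ↥I₀ → Bool, cubeSign ε *
        (ZMod.stdAddChar (∑ a : Fin m, M a a * cubeTorus I₀ α β ε a) * (p : ℂ) ^ (m * m))) =
        (p : ℂ) ^ (m * m) * (ZMod.stdAddChar (∑ a ∈ I₀ᶜ, M a a * α a) *
          ∏ i : ↥I₀, (ZMod.stdAddChar (M i i * α i) - ZMod.stdAddChar (M i i * β i))) := by
      rw [← cube_signed_phase, Finset.mul_sum]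
      exact Finset.sum_congr rfl fun ε _ => by ring
    rw [hfac]
    by_cases hdiag : ∀ i ∈ I₀, M i i ≠ 0
    · -- then `rk M ≥ k + 1`, so `c M = 0`
      have hr : k < M.rank := by
        have := card_le_rank_of_triangular_block I₀ M hup hdiag
        omega
      rw [hc M hr, zero_mul]
    · -- some diagonal entry on `I₀` vanishes: the corresponding factor is `ψ(0) − ψ(0) = 0`
      push Not at hdiag
      obtain ⟨i, hi, hMi⟩ := hdiag
      have hzero : (∏ i : ↥I₀, (ZMod.stdAddChar (M i i * α i) - ZMod.stdAddChar (M i i * β i))) = 0 :=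
        Finset.prod_eq_zero (Finset.mem_univ ⟨i, hi⟩) (by simp [hMi])
      rw [hzero]
      ring
  · simp only [if_neg hup, mul_zero, Finset.sum_const_zero]

/-- The cube point equals `1` only at the vertex `t_ε = 1` with zero pattern entries. -/
theorem cubePt_eq_one_iff (I₀ : Finset (Fin m)) (α β : Fin m → ZMod p)
    (hα : ∀ i ∈ I₀, α i ≠ 0) (hβ : ∀ i ∈ I₀, β i ≠ 0) (hα' : ∀ i, i ∉ I₀ → α i ≠ 0)
    (ε : ↥I₀ → Bool) (e : CMat p m) :
    cubePt I₀ α β ε e = 1 ↔ cubeTorus I₀ α β ε = 1 ∧ cubeNil I₀ e = 0 := by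
  have hτ0 : ∀ i, cubeTorus I₀ α β ε i ≠ 0 := by
    intro i
    by_cases hi : i ∈ I₀
    · simp only [cubeTorus, dif_pos hi]
      split_ifs
      · exact hα i hi
      · exact hβ i hi
    · simp only [cubeTorus, dif_neg hi]
      exact hα' i hi
  have hent : ∀ a b : Fin m, cubePt I₀ α β ε e a b =
      cubeTorus I₀ α β ε a * ((if a = b then 1 else 0) + cubeNil I₀ e a b) := by
    intro a b
    rw [cubePt, Matrix.diagonal_mul, Matrix.add_apply, Matrix.one_apply]
  have hnil_diag : ∀ a : Fin m, cubeNil I₀ e a a = 0 := fun a => by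
    simp [cubeNil]
  constructor
  · intro h
    have hab : ∀ a b : Fin m, cubeTorus I₀ α β ε a * ((if a = b then 1 else 0) + cubeNil I₀ e a b) =
        if a = b then 1 else 0 := by
      intro a b
      rw [← hent, h, Matrix.one_apply]
    constructor
    · funext i
      rw [Pi.one_apply]
      simpa [hnil_diag] using hab i i
    · ext a b
      rw [Matrix.zero_apply]
      by_cases hab' : a = b
      · subst hab'; exact hnil_diag a
      · have h2 : cubeTorus I₀ α β ε a * cubeNil I₀ e a b = 0 := by simpa [hab'] using hab a b
        exact (mul_eq_zero.1 h2).resolve_left (hτ0 a)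
  · rintro ⟨hτ, hn⟩
    rw [cubePt, hτ, hn, add_zero, mul_one]
    exact Matrix.diagonal_one

/-- **NO LEVEL-`k` IDENTITY TEST ON A SET CONTAINING A TORUS CUBE THROUGH `1`.**  If `S ⊆ M_m(𝔽_p)`
contains every cube point `t_ε (1 + n_e)` (`|I₀| = k+1`, `α, β` non-zero and distinct on `I₀`, `α`
non-zero off `I₀`) and `1` is a vertex of the torus cube (`t_{ε₁} = 1`), then no rank-`≤ k`-supported
`c` has `f_c(1) = 1` and `f_c = 0` on `S ∖ {1}`. -/
theorem no_idTest_of_torusCube (k : ℕ) (I₀ : Finset (Fin m)) (hI : I₀.card = k + 1)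
    (α β : Fin m → ZMod p) (hα : ∀ i ∈ I₀, α i ≠ 0) (hβ : ∀ i ∈ I₀, β i ≠ 0)
    (hα' : ∀ i, i ∉ I₀ → α i ≠ 0) (hαβ : ∀ i ∈ I₀, α i ≠ β i)
    (ε₁ : ↥I₀ → Bool) (hε₁ : cubeTorus I₀ α β ε₁ = 1)
    (S : Set (CMat p m)) (hS : ∀ (ε : ↥I₀ → Bool) (e : CMat p m), cubePt I₀ α β ε e ∈ S)
    (c : CMat p m → ℂ) (hc : ∀ M : CMat p m, k < M.rank → c M = 0)
    (h1 : fourierMat c 1 = 1) (h0 : ∀ s ∈ S, s ≠ 1 → fourierMat c s = 0) : False := by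
  have hsum := torusCube_sum_eq_zero k I₀ hI α β hα hβ c hc
  have huniq : ∀ ε : ↥I₀ → Bool, cubeTorus I₀ α β ε = 1 → ε = ε₁ := by
    intro ε hε
    funext i
    have h₁ := congrFun hε i
    have h₂ := congrFun hε₁ i
    simp only [cubeTorus, dif_pos i.2, Pi.one_apply] at h₁ h₂
    -- exactly one of `α i`, `β i` equals `1`
    cases hεi : ε i <;> cases hε₁i : ε₁ i <;> simp_all
    · exact absurd (h₂.trans h₁.symm) (hαβ i i.2)
    · exact absurd (h₁.trans h₂.symm) (hαβ i i.2)
  have hval : ∀ (ε : ↥I₀ → Bool) (e : CMat p m), cubeSign ε * fourierMat c (cubePt I₀ α β ε e) =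
      if ε = ε₁ ∧ cubeNil I₀ e = 0 then cubeSign ε₁ else 0 := by
    intro ε e
    by_cases h : cubePt I₀ α β ε e = 1
    · obtain ⟨hτ, hn⟩ := (cubePt_eq_one_iff I₀ α β hα hβ hα' ε e).1 h
      have hεε := huniq ε hτ
      subst hεε
      rw [h, h1, mul_one, if_pos ⟨rfl, hn⟩]
    · rw [h0 _ (hS ε e) h, mul_zero, if_neg]
      rintro ⟨rfl, hn⟩
      exact h ((cubePt_eq_one_iff I₀ α β hα hβ hα' ε e).2 ⟨hε₁, hn⟩)
  simp_rw [hval] at hsum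
  rw [Finset.sum_comm] at hsum
  have hcount : (∑ e : CMat p m, ∑ ε : ↥I₀ → Bool,
      (if ε = ε₁ ∧ cubeNil I₀ e = 0 then cubeSign ε₁ else (0 : ℂ))) =
      ((Finset.univ.filter fun e : CMat p m => cubeNil I₀ e = 0).card : ℂ) * cubeSign ε₁ := by
    have : ∀ e : CMat p m, (∑ ε : ↥I₀ → Bool, (if ε = ε₁ ∧ cubeNil I₀ e = 0 then cubeSign ε₁ else (0 : ℂ))) =
        if cubeNil I₀ e = 0 then cubeSign ε₁ else 0 := by
      intro e
      by_cases he : cubeNil I₀ e = 0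
      · simp [he, Finset.sum_ite_eq']
      · simp [he]
    simp_rw [this]
    rw [Finset.sum_ite, Finset.sum_const_zero, add_zero, Finset.sum_const, nsmul_eq_mul]
  rw [hcount] at hsum
  have hpos : 0 < (Finset.univ.filter fun e : CMat p m => cubeNil I₀ e = 0).card :=
    Finset.card_pos.2 ⟨0, by simp [cubeNil]; rfl⟩
  have hsign : cubeSign ε₁ ≠ 0 := by
    unfold cubeSign
    exact Finset.prod_ne_zero_iff.2 fun i _ => by split_ifs <;> norm_num
  have hne : ((Finset.univ.filter fun e : CMat p m => cubeNil I₀ e = 0).card : ℂ) ≠ 0 :=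
    Nat.cast_ne_zero.2 hpos.ne'
  exact mul_ne_zero hne hsign hsum

end Summit.MatrixMultiplication.MatrixMultiplication.Theorems.SubgroupIdentityDesigns.Negative

end
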